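import Literature.MathematicalPhysics.QuantumLattice.FermiRG.FST2SecondOrderStrings
import Literature.MathematicalPhysics.QuantumLattice.FermiRG.FST2ScaleCutoffExists
import Literature.MathematicalPhysics.QuantumLattice.FermiRG.FST2FermiCurveParam
import Mathlib.Analysis.SpecialFunctions.SmoothTransition
import Mathlib.Analysis.SpecialFunctions.Sqrt
import Mathlib.Analysis.InnerProductSpace.Calculus
import Mathlib.Analysis.InnerProductSpace.Convex
import Mathlib.Analysis.Normed.Module.RCLike.Real
import Mathlib.Analysis.Real.Pi.Bounds
import HarnessLib

/-!
# Feldman–Salmhofer–Trubowitz II: the tubular coordinates `(ρ, θ)` and the hypotheses of the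
# strings theorem are non-vacuous (an explicit isotropic example)

Proof companion (theorems only: no definitions, no named facts) of `FST2SecondOrderStrings.lean`
(gate-hubbard-kl wave file F4c). Source:

* [II] J. Feldman, M. Salmhofer, E. Trubowitz, *Perturbation theory around non-nested Fermi surfaces II.
  Regularity of the moving Fermi surface: RPA contributions*, Comm. Pure Appl. Math. **51** (1998)
  1133–1246, arXiv:cond-mat/9701073 (`FeldmanSalmhoferTrubowitz1998`); locators `p.N Lm` = chunk
  `pNNNN.txt`, line `m`, of the `lit read arxiv:cond-mat/9701073` render of the arXiv TeX.

## What is proved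

`FST2SecondOrderStrings.TubularCoords cr e k r₀` records, as DATA, the radial and angular coordinates
`(ρ, θ) ↦ p(ρ, θ)`, `e(p(ρ, θ)) = ρ`, of [II §2.2, p.8 L35–60] (= [I, Lemma 2.1]: the integral curves of a
`C^∞` periodic vector field `u` transversal to the Fermi curve, reparametrised by `ρ = e`, started on the
constant-speed angular coordinate), over which the named facts `StringsTheorem` ([II] Theorem 3.5) and
— through `FermiCurveParam` — `LemmaJaythree` ([II] Lemma 3.1) are typed. In [II] this object is
CONSTRUCTED for every band satisfying (A2), (A3); that construction needs the `C^k` dependence of ODE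
flows on initial data, which Mathlib does not have, and is NOT attempted here. This file proves instead
that the datum, and the ENTIRE hypothesis prefix of both named facts, is inhabited by an explicit example,
so that neither fact is vacuously true:

* `exists_band_tubularCoords`: let `dim E = 2` and let `cr` be any crystal datum whose fundamental domain
  contains the ball `‖p‖ ≤ 3` and is bounded (e.g. `Crystal.cubic 2`: `Γ# = 2πℤ²`, `F = [-π, π)²`,
  `3 < π`). The isotropic band `e(p) = (|p̄|² - 1)/2` near the unit circle (`p̄` the representative of `p`
  in `F`), continued to the constant `1` away from it by Mathlib's `Real.smoothTransition` and made
  `Γ#`-periodic through the crystal's unique-representative map, is `C^∞`, periodic, has Fermi curve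
  `S ∩ F` = the unit circle, satisfies (A2)_{k,0} for every `k`, (A3) (both halves: `S ∩ F = ∂(unit
  disc)`), (Sy) hence (A4) (`FST2FermiCurveParam.HypSy.hypA4`), (A5), admits the geometric constants
  `GeomConstants e K (1/8) (1/2) 1`, an angular coordinate `θ ↦ cos θ b₀ + sin θ b₁`
  (`FermiCurveParam`), and — the point of the file — the tubular coordinates
  `p(ρ, θ) = √(1 + 2ρ) (cos θ b₀ + sin θ b₁)`, `u = ∇e`, `|ρ| < 1/4`, inhabit `TubularCoords cr e k (1/8)`
  for every `k` (`∂_ρ p = u/(u·∇e)` because `∇e(p) = p` there).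
* `closedBall_subset_fundamentalDomain_cubic`, `isBounded_fundamentalDomain_cubic`,
  `measurableSet_fundamentalDomain_cubic`: the cubic crystal `Crystal.cubic d` of [II p.6 L112–114]
  (`Γ# = 2πℤ^d`, `F = [-π, π)^d`) qualifies.
* `stringsTheorem_hypotheses_nonempty`: for every `k ≥ 2` the universally quantified hypotheses of
  `StringsTheorem` preceding "`∃ Q`" and of `LemmaJaythree` preceding "`∃ Δ`" (dimension two, `F`
  measurable and bounded, (A2)_{k,0}, (A3) both halves, (A4), (A5), `GeomConstants e K r₀ g₀ wmin`,
  `M ≥ max{4³, 1/r₀}`, together with an inhabitant of `FermiCurveParam cr e`, of `TubularCoords cr e k r₀`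
  and of `ScaleCutoff M` — the last from `FST2ScaleCutoffExists.lean`) are simultaneously satisfiable
  over `Crystal.cubic 2`.

How: the representative map `red` of the crystal is the translation by a fixed lattice vector near any
point whose representative lies in the ball `‖p‖ < 5/2`, and maps a neighbourhood of any other point into
`‖p‖ ≥ 2`, where the profile is constant (§2); hence `e = φ(‖red ·‖²)` is smooth and periodic, equal to
the shifted parabola `(‖· + c‖² - 1)/2` near the tube, with gradient `red q` and Hessian the identity
there (§3); all derivatives are bounded by periodicity and compactness of the closure of `F`. The circle
lemmas (§5) identify `S ∩ F` with the image of one period of `θ ↦ cos θ b₀ + sin θ b₁`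
(`Real.Angle.cos_sin_inj`, `Complex.arg`).

Honest scope: a TOY witness of consistency of the typed hypotheses; nothing here instantiates the Hubbard
band, and nothing asserts or denies the Kohn–Luttinger programme's hypothesis H1.
-/

noncomputable section

open Set Filter Metric
open scoped NNReal Topology RealInnerProductSpace ContDiff

namespace Literature.MathematicalPhysics.QuantumLattice.FermiRG

open Literature.Analysis.FunctionSpaces (MemContDiffHolder eSupNorm eSupNorm_lt_top_iff)

/-! ### §1 The radial profile: `(s - 1)/2` for `s ≤ 9/4`, `≡ 1` for `s ≥ 4`, `≥ 5/8` in between -/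

section Profile

variable {φ : ℝ → ℝ}
  (hφ : φ = fun s => (s - 1) / 2 + Real.smoothTransition ((s - 9 / 4) * (4 / 7)) * ((3 - s) / 2))
include hφ

/-- The profile is smooth. [folklore] -/
private theorem profile_contDiff : ContDiff ℝ ∞ φ := by
  subst hφ
  refine ((contDiff_id.sub contDiff_const).div_const 2).add
    ((Real.smoothTransition.contDiff.comp ((contDiff_id.sub contDiff_const).mul contDiff_const)).mul
      ((contDiff_const.sub contDiff_id).div_const 2))

/-- Near the Fermi curve the profile is `(s - 1)/2`. [folklore] -/
private theorem profile_eq_of_le {s : ℝ} (hs : s ≤ 9 / 4) : φ s = (s - 1) / 2 := by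
  subst hφ
  have h0 : Real.smoothTransition ((s - 9 / 4) * (4 / 7)) = 0 :=
    Real.smoothTransition.zero_of_nonpos (by nlinarith)
  simp [h0]

/-- Far from the Fermi curve the profile is `1`. [folklore] -/
private theorem profile_eq_one_of_le {s : ℝ} (hs : 4 ≤ s) : φ s = 1 := by
  subst hφ
  have h1 : Real.smoothTransition ((s - 9 / 4) * (4 / 7)) = 1 :=
    Real.smoothTransition.one_of_one_le (by nlinarith)
  simp only [h1]
  ring

/-- Outside the disc `s < 9/4` the profile is at least `5/8`. [folklore] -/
private theorem profile_ge {s : ℝ} (hs : 9 / 4 ≤ s) : 5 / 8 ≤ φ s := by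
  subst hφ
  have h0 := Real.smoothTransition.nonneg ((s - 9 / 4) * (4 / 7))
  have h1 := Real.smoothTransition.le_one ((s - 9 / 4) * (4 / 7))
  simp only
  nlinarith

/-- The profile vanishes only at `s = 1`. [folklore] -/
private theorem eq_one_of_profile_eq_zero {s : ℝ} (hs : φ s = 0) : s = 1 := by
  by_cases h : s ≤ 9 / 4
  · rw [profile_eq_of_le hφ h] at hs
    linarith
  · have := profile_ge hφ (le_of_not_ge h)
    linarith

/-- `|φ s| < 5/8` forces `s < 9/4`. [folklore] -/
private theorem lt_of_abs_profile_lt {s : ℝ} (hs : |φ s| < 5 / 8) : s < 9 / 4 := by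
  by_contra h
  have := profile_ge hφ (le_of_not_gt h)
  rw [abs_lt] at hs
  linarith

end Profile

/-! ### §2 The unique-representative map of a crystal whose fundamental domain contains `‖p‖ ≤ 3` -/

section Red

variable {E : Type*} [NormedAddCommGroup E] [InnerProductSpace ℝ E] {cr : Crystal E} {red : E → E}
  (hred : ∀ q, red q ∈ cr.fundamentalDomain ∧ red q - q ∈ cr.dualLattice)
include hred

/-- Uniqueness of the representative: any lattice translate of `q` inside `F` is `red q`. [folklore] -/
private theorem red_eq_add {q γ : E} (hγ : γ ∈ cr.dualLattice) (hq : q + γ ∈ cr.fundamentalDomain) :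
    red q = q + γ := by
  obtain ⟨g, -, huniq⟩ := cr.existsUnique_rep q
  have h1 := huniq ⟨red q - q, (hred q).2⟩ (by simpa using (hred q).1)
  have h2 := huniq ⟨γ, hγ⟩ hq
  have h3 : red q - q = γ := by
    have := congrArg Subtype.val (h1.trans h2.symm)
    simpa using this
  rw [← h3]; abel

/-- Points of `F` are their own representatives. [folklore] -/
private theorem red_eq_self {q : E} (hq : q ∈ cr.fundamentalDomain) : red q = q := by
  have := red_eq_add hred (cr.dualLattice.zero_mem) (by simpa using hq)
  simpa using this

/-- The representative map is lattice periodic. [folklore] -/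
private theorem red_add {q γ : E} (hγ : γ ∈ cr.dualLattice) : red (q + γ) = red q := by
  have hmem : red q - q - γ ∈ cr.dualLattice := cr.dualLattice.sub_mem (hred q).2 hγ
  have h := red_eq_add hred (q := q + γ) hmem (by
    have : q + γ + (red q - q - γ) = red q := by abel
    rw [this]; exact (hred q).1)
  rw [h]; abel

variable (hF : closedBall (0 : E) 3 ⊆ cr.fundamentalDomain)
include hF

/-- Near a point whose representative lies well inside the ball, `red` is the translation by the same
lattice vector. [folklore] -/
private theorem red_eq_of_near {q q' : E} (hq : ‖red q‖ < 5 / 2) (hq' : dist q' q < 1 / 2) :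
    red q' = q' + (red q - q) := by
  refine red_eq_add hred (hred q).2 (hF ?_)
  rw [mem_closedBall, dist_zero_right]
  have : q' + (red q - q) = red q + (q' - q) := by abel
  rw [this]
  refine (norm_add_le _ _).trans ?_
  rw [← dist_eq_norm]
  linarith

/-- Near a point whose representative is far out, all representatives are far out. [folklore] -/
private theorem two_le_norm_red_of_near {q q' : E} (hq : 5 / 2 ≤ ‖red q‖) (hq' : dist q' q < 1 / 2) :
    2 ≤ ‖red q'‖ := by
  by_contra h
  have h' : ‖red q'‖ < 5 / 2 := by linarith [lt_of_not_ge h]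
  have hqq' : dist q q' < 1 / 2 := by rwa [dist_comm]
  have hred_q : red q = q + (red q' - q') := red_eq_of_near hred hF h' hqq'
  have : ‖red q‖ ≤ ‖red q'‖ + dist q q' := by
    rw [hred_q, show q + (red q' - q') = red q' + (q - q') by abel, dist_eq_norm]
    exact norm_add_le _ _
  linarith

/-- The representative of `-q` is `-red q` when `red q` lies well inside the ball. [folklore] -/
private theorem red_neg_of_norm_lt {q : E} (hq : ‖red q‖ < 5 / 2) : red (-q) = -red q := by
  have h := red_eq_add hred (q := -q) (cr.dualLattice.neg_mem (hred q).2) (hF ?_)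
  · rw [h]; abel
  · rw [mem_closedBall, dist_zero_right, show -q + -(red q - q) = -red q by abel, norm_neg]
    linarith

end Red

/-! ### §3 The isotropic band `e = φ(‖red ·‖²)`: smoothness, periodicity, values, gradient, Hessian -/

section Band

variable {E : Type*} [NormedAddCommGroup E] [InnerProductSpace ℝ E] {cr : Crystal E} {φ : ℝ → ℝ}
  {red : E → E} {e : E → ℝ}

/-- The shifted parabola `q ↦ (‖q + c‖² - 1)/2` has derivative `⟨q + c, ·⟩`. [folklore] -/
private theorem hasFDerivAt_shiftedSq (c q : E) :
    HasFDerivAt (fun q' : E => (‖q' + c‖ ^ 2 - 1) / 2) (innerSL ℝ (q + c)) q := by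
  have h1 : HasFDerivAt (fun q' : E => ‖q' + c‖ ^ 2)
      ((2 : ℕ) • (innerSL ℝ (q + c)).comp (ContinuousLinearMap.id ℝ E)) q :=
    ((hasFDerivAt_id q).add_const c).norm_sq
  have h2 := (h1.sub_const 1).mul_const (2 : ℝ)⁻¹
  have h3 : (fun q' : E => (‖q' + c‖ ^ 2 - 1) / 2) = fun q' => (‖q' + c‖ ^ 2 - 1) * 2⁻¹ := by
    funext q'; ring
  rw [h3]
  refine h2.congr_fderiv (ContinuousLinearMap.ext fun v => ?_)
  simp only [FunLike.coe_smul, FunLike.coe_add, Pi.smul_apply, Pi.add_apply,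
    ContinuousLinearMap.comp_id, two_nsmul, smul_eq_mul]
  ring

/-- The band is lattice periodic. [folklore] -/
private theorem band_add (hred : ∀ q, red q ∈ cr.fundamentalDomain ∧ red q - q ∈ cr.dualLattice)
    (he : e = fun q => φ (‖red q‖ ^ 2)) {q γ : E} (hγ : γ ∈ cr.dualLattice) : e (q + γ) = e q := by
  subst he
  show φ (‖red (q + γ)‖ ^ 2) = φ (‖red q‖ ^ 2)
  rw [red_add hred hγ]

/-- The band is `C^∞`: near every point it is either the composition of the profile with a shifted
`‖·‖²`, or constant. [folklore] -/
private theorem band_contDiff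
    (hφ : φ = fun s => (s - 1) / 2 + Real.smoothTransition ((s - 9 / 4) * (4 / 7)) * ((3 - s) / 2))
    (hred : ∀ q, red q ∈ cr.fundamentalDomain ∧ red q - q ∈ cr.dualLattice)
    (hF : closedBall (0 : E) 3 ⊆ cr.fundamentalDomain) (he : e = fun q => φ (‖red q‖ ^ 2)) :
    ContDiff ℝ (⊤ : ℕ∞) e := by
  subst he
  refine contDiff_iff_contDiffAt.2 fun q => ?_
  by_cases hq : ‖red q‖ < 5 / 2
  · have hev : (fun q' => φ (‖red q'‖ ^ 2)) =ᶠ[𝓝 q] fun q' => φ (‖q' + (red q - q)‖ ^ 2) := by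
      filter_upwards [Metric.ball_mem_nhds q (by norm_num : (0 : ℝ) < 1 / 2)] with q' hq'
      rw [red_eq_of_near hred hF hq (mem_ball.1 hq')]
    refine ContDiffAt.congr_of_eventuallyEq ?_ hev
    exact ((profile_contDiff hφ).comp
      ((contDiff_norm_sq ℝ).comp (contDiff_id.add contDiff_const))).contDiffAt
  · have hev : (fun q' => φ (‖red q'‖ ^ 2)) =ᶠ[𝓝 q] fun _ => (1 : ℝ) := by
      filter_upwards [Metric.ball_mem_nhds q (by norm_num : (0 : ℝ) < 1 / 2)] with q' hq'
      have h2 := two_le_norm_red_of_near hred hF (le_of_not_gt hq) (mem_ball.1 hq')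
      exact profile_eq_one_of_le hφ (by nlinarith)
    exact contDiffAt_const.congr_of_eventuallyEq hev

omit [InnerProductSpace ℝ E] in
/-- Near the Fermi curve the band is `(‖red q‖² - 1)/2`. [folklore] -/
private theorem band_eq_of_norm_lt
    (hφ : φ = fun s => (s - 1) / 2 + Real.smoothTransition ((s - 9 / 4) * (4 / 7)) * ((3 - s) / 2))
    (he : e = fun q => φ (‖red q‖ ^ 2)) {q : E} (h : ‖red q‖ < 3 / 2) :
    e q = (‖red q‖ ^ 2 - 1) / 2 := by
  subst he
  exact profile_eq_of_le hφ (by nlinarith [norm_nonneg (red q)])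

omit [InnerProductSpace ℝ E] in
/-- `|e q| < 5/8` only happens near the Fermi curve. [folklore] -/
private theorem norm_red_lt_of_abs_lt
    (hφ : φ = fun s => (s - 1) / 2 + Real.smoothTransition ((s - 9 / 4) * (4 / 7)) * ((3 - s) / 2))
    (he : e = fun q => φ (‖red q‖ ^ 2)) {q : E} (h : |e q| < 5 / 8) : ‖red q‖ < 3 / 2 := by
  subst he
  have h' := lt_of_abs_profile_lt hφ h
  nlinarith [norm_nonneg (red q)]

omit [InnerProductSpace ℝ E] in
/-- The Fermi surface of the band: `e q = 0 ↔ ‖red q‖ = 1`. [folklore] -/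
private theorem band_eq_zero_iff
    (hφ : φ = fun s => (s - 1) / 2 + Real.smoothTransition ((s - 9 / 4) * (4 / 7)) * ((3 - s) / 2))
    (he : e = fun q => φ (‖red q‖ ^ 2)) {q : E} : e q = 0 ↔ ‖red q‖ = 1 := by
  constructor
  · intro h0
    have h1 : ‖red q‖ ^ 2 = 1 := by
      subst he
      exact eq_one_of_profile_eq_zero hφ h0
    exact (pow_eq_one_iff_of_nonneg (norm_nonneg _) two_ne_zero).1 h1
  · intro h1
    rw [band_eq_of_norm_lt hφ he (by rw [h1]; norm_num), h1]
    norm_num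

/-- Near the Fermi curve the band agrees, on a neighbourhood, with a shifted parabola. [folklore] -/
private theorem band_eventuallyEq
    (hφ : φ = fun s => (s - 1) / 2 + Real.smoothTransition ((s - 9 / 4) * (4 / 7)) * ((3 - s) / 2))
    (hred : ∀ q, red q ∈ cr.fundamentalDomain ∧ red q - q ∈ cr.dualLattice)
    (hF : closedBall (0 : E) 3 ⊆ cr.fundamentalDomain) (he : e = fun q => φ (‖red q‖ ^ 2)) {q : E}
    (h : ‖red q‖ < 3 / 2) : e =ᶠ[𝓝 q] fun q' => (‖q' + (red q - q)‖ ^ 2 - 1) / 2 := by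
  have hδ : 0 < 3 / 2 - ‖red q‖ := by linarith
  filter_upwards [Metric.ball_mem_nhds q (lt_min hδ (by norm_num : (0 : ℝ) < 1 / 2))] with q' hq'
  rw [mem_ball, lt_min_iff] at hq'
  have hr : red q' = q' + (red q - q) := red_eq_of_near hred hF (by linarith) hq'.2
  have hn : ‖q' + (red q - q)‖ < 3 / 2 := by
    calc ‖q' + (red q - q)‖ = ‖red q + (q' - q)‖ := by congr 1; abel
      _ ≤ ‖red q‖ + ‖q' - q‖ := norm_add_le _ _
      _ < 3 / 2 := by rw [← dist_eq_norm]; linarith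
  rw [← hr] at hn ⊢
  exact band_eq_of_norm_lt hφ he hn

/-- The derivative of the band near the Fermi curve: `De(q) = ⟨red q, ·⟩`. [folklore] -/
private theorem band_hasFDerivAt
    (hφ : φ = fun s => (s - 1) / 2 + Real.smoothTransition ((s - 9 / 4) * (4 / 7)) * ((3 - s) / 2))
    (hred : ∀ q, red q ∈ cr.fundamentalDomain ∧ red q - q ∈ cr.dualLattice)
    (hF : closedBall (0 : E) 3 ⊆ cr.fundamentalDomain) (he : e = fun q => φ (‖red q‖ ^ 2)) {q : E}
    (h : ‖red q‖ < 3 / 2) : HasFDerivAt e (innerSL ℝ (red q)) q := by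
  have h1 := (hasFDerivAt_shiftedSq (red q - q) q).congr_of_eventuallyEq
    (band_eventuallyEq hφ hred hF he h)
  rwa [add_sub_cancel] at h1

variable [CompleteSpace E]

/-- The gradient of the band near the Fermi curve: `∇e(q) = red q`. [folklore] -/
private theorem band_gradient
    (hφ : φ = fun s => (s - 1) / 2 + Real.smoothTransition ((s - 9 / 4) * (4 / 7)) * ((3 - s) / 2))
    (hred : ∀ q, red q ∈ cr.fundamentalDomain ∧ red q - q ∈ cr.dualLattice)
    (hF : closedBall (0 : E) 3 ⊆ cr.fundamentalDomain) (he : e = fun q => φ (‖red q‖ ^ 2)) {q : E}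
    (h : ‖red q‖ < 3 / 2) : gradient e q = red q := by
  have h2 : InnerProductSpace.toDual ℝ E (red q) = innerSL ℝ (red q) :=
    ContinuousLinearMap.ext fun v => rfl
  have h1 : HasGradientAt e (red q) q := by
    rw [hasGradientAt_iff_hasFDerivAt, h2]
    exact band_hasFDerivAt hφ hred hF he h
  exact h1.gradient

omit [CompleteSpace E] in
/-- The Hessian of the band near the Fermi curve is the identity: `(v, e''(q) v) = ‖v‖²`. [folklore] -/
private theorem band_hessQuad
    (hφ : φ = fun s => (s - 1) / 2 + Real.smoothTransition ((s - 9 / 4) * (4 / 7)) * ((3 - s) / 2))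
    (hred : ∀ q, red q ∈ cr.fundamentalDomain ∧ red q - q ∈ cr.dualLattice)
    (hF : closedBall (0 : E) 3 ⊆ cr.fundamentalDomain) (he : e = fun q => φ (‖red q‖ ^ 2)) {q : E}
    (h : ‖red q‖ < 3 / 2) (v : E) : hessQuad e q v = ‖v‖ ^ 2 := by
  unfold hessQuad
  rw [((band_eventuallyEq hφ hred hF he h).iteratedFDeriv ℝ 2).self_of_nhds, iteratedFDeriv_two_apply]
  have hfd : fderiv ℝ (fun q' : E => (‖q' + (red q - q)‖ ^ 2 - 1) / 2) =
      fun q' => innerSL ℝ (q' + (red q - q)) :=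
    funext fun q' => (hasFDerivAt_shiftedSq (red q - q) q').fderiv
  rw [hfd]
  have h2 : HasFDerivAt (fun q' : E => innerSL ℝ (q' + (red q - q)))
      ((innerSL ℝ : E →L[ℝ] E →L[ℝ] ℝ).comp (ContinuousLinearMap.id ℝ E)) q :=
    (innerSL ℝ : E →L[ℝ] E →L[ℝ] ℝ).hasFDerivAt.comp q ((hasFDerivAt_id q).add_const (red q - q))
  rw [h2.fderiv]
  change inner ℝ v v = ‖v‖ ^ 2
  exact real_inner_self_eq_norm_sq v

omit [CompleteSpace E] in
/-- The band is symmetric, `e(-q) = e(q)` ((Sy) of [II]). [folklore] -/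
private theorem band_neg
    (hφ : φ = fun s => (s - 1) / 2 + Real.smoothTransition ((s - 9 / 4) * (4 / 7)) * ((3 - s) / 2))
    (hred : ∀ q, red q ∈ cr.fundamentalDomain ∧ red q - q ∈ cr.dualLattice)
    (hF : closedBall (0 : E) 3 ⊆ cr.fundamentalDomain) (he : e = fun q => φ (‖red q‖ ^ 2)) (q : E) :
    e (-q) = e q := by
  subst he
  show φ (‖red (-q)‖ ^ 2) = φ (‖red q‖ ^ 2)
  by_cases hq : ‖red q‖ < 5 / 2
  · rw [red_neg_of_norm_lt hred hF hq, norm_neg]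
  · have hq' : ¬‖red (-q)‖ < 5 / 2 := by
      intro h
      have h1 := red_neg_of_norm_lt hred hF h
      rw [neg_neg] at h1
      rw [h1, norm_neg] at hq
      exact hq h
    rw [profile_eq_one_of_le hφ (by nlinarith [le_of_not_gt hq]),
      profile_eq_one_of_le hφ (by nlinarith [le_of_not_gt hq'])]

omit [CompleteSpace E] in
/-- All derivatives of the band are bounded (it is smooth and periodic with a bounded fundamental
domain). [folklore] -/
private theorem band_exists_bound [FiniteDimensional ℝ E]
    (hφ : φ = fun s => (s - 1) / 2 + Real.smoothTransition ((s - 9 / 4) * (4 / 7)) * ((3 - s) / 2))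
    (hred : ∀ q, red q ∈ cr.fundamentalDomain ∧ red q - q ∈ cr.dualLattice)
    (hF : closedBall (0 : E) 3 ⊆ cr.fundamentalDomain) (he : e = fun q => φ (‖red q‖ ^ 2))
    (hFb : Bornology.IsBounded cr.fundamentalDomain) (j : ℕ) :
    ∃ K : ℝ, ∀ q : E, ‖iteratedFDeriv ℝ j e q‖ ≤ K := by
  have hcont : Continuous (iteratedFDeriv ℝ j e) :=
    (band_contDiff hφ hred hF he).continuous_iteratedFDeriv (by exact_mod_cast le_top)
  obtain ⟨K, hK⟩ := hFb.isCompact_closure.exists_bound_of_continuousOn hcont.continuousOn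
  refine ⟨K, fun q => ?_⟩
  have hper : iteratedFDeriv ℝ j e q = iteratedFDeriv ℝ j e (red q) := by
    have h1 : (fun z => e (z + (red q - q))) = e := funext fun z => band_add hred he (hred q).2
    have h2 := iteratedFDeriv_comp_add_right (𝕜 := ℝ) (f := e) j (red q - q) q
    rw [h1, add_sub_cancel] at h2
    exact h2
  rw [hper]
  exact hK _ (subset_closure (hred q).1)

omit [CompleteSpace E] in
/-- The band is in `C^{k,0}` for every `k`. [folklore] -/
private theorem band_memContDiffHolder [FiniteDimensional ℝ E]
    (hφ : φ = fun s => (s - 1) / 2 + Real.smoothTransition ((s - 9 / 4) * (4 / 7)) * ((3 - s) / 2))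
    (hred : ∀ q, red q ∈ cr.fundamentalDomain ∧ red q - q ∈ cr.dualLattice)
    (hF : closedBall (0 : E) 3 ⊆ cr.fundamentalDomain) (he : e = fun q => φ (‖red q‖ ^ 2))
    (hFb : Bornology.IsBounded cr.fundamentalDomain) (k : ℕ) : MemContDiffHolder k 0 e := by
  refine ⟨(band_contDiff hφ hred hF he).of_le (by exact_mod_cast le_top), fun j _ => ?_, ?_⟩
  · obtain ⟨K, hK⟩ := band_exists_bound hφ hred hF he hFb j
    exact eSupNorm_lt_top_iff.2 ⟨K, hK⟩
  · obtain ⟨K, hK⟩ := band_exists_bound hφ hred hF he hFb k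
    refine ⟨(2 * K).toNNReal, fun x y => ?_⟩
    rw [NNReal.coe_zero, ENNReal.rpow_zero, mul_one, edist_dist, dist_eq_norm]
    have hxy : ‖iteratedFDeriv ℝ k e x - iteratedFDeriv ℝ k e y‖ ≤ 2 * K :=
      (norm_sub_le _ _).trans (by linarith [hK x, hK y])
    exact (ENNReal.ofReal_le_ofReal hxy).trans le_rfl

/-- The gradient of the band is `C^∞`. [folklore] -/
private theorem band_gradient_contDiff
    (hφ : φ = fun s => (s - 1) / 2 + Real.smoothTransition ((s - 9 / 4) * (4 / 7)) * ((3 - s) / 2))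
    (hred : ∀ q, red q ∈ cr.fundamentalDomain ∧ red q - q ∈ cr.dualLattice)
    (hF : closedBall (0 : E) 3 ⊆ cr.fundamentalDomain) (he : e = fun q => φ (‖red q‖ ^ 2)) :
    ContDiff ℝ (⊤ : ℕ∞) (gradient e) := by
  have h := (contDiff_infty_iff_fderiv.1 (band_contDiff hφ hred hF he)).2
  have hg : gradient e = fun q => (InnerProductSpace.toDual ℝ E).symm (fderiv ℝ e q) := rfl
  rw [hg]
  exact (InnerProductSpace.toDual ℝ E).symm.contDiff.comp h

/-- The gradient of the band is lattice periodic. [folklore] -/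
private theorem band_gradient_add
    (hred : ∀ q, red q ∈ cr.fundamentalDomain ∧ red q - q ∈ cr.dualLattice)
    (he : e = fun q => φ (‖red q‖ ^ 2)) {q γ : E} (hγ : γ ∈ cr.dualLattice) :
    gradient e (q + γ) = gradient e q := by
  have h1 : (fun z => e (z + γ)) = e := funext fun z => band_add hred he hγ
  unfold gradient
  rw [← fderiv_comp_add_right γ, h1]

omit [CompleteSpace E] in
/-- The representatives of the Fermi curve form the unit circle: `S ∩ F = {‖q‖ = 1}`. [folklore] -/
private theorem band_fermiSurfaceRep
    (hφ : φ = fun s => (s - 1) / 2 + Real.smoothTransition ((s - 9 / 4) * (4 / 7)) * ((3 - s) / 2))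
    (hred : ∀ q, red q ∈ cr.fundamentalDomain ∧ red q - q ∈ cr.dualLattice)
    (hF : closedBall (0 : E) 3 ⊆ cr.fundamentalDomain) (he : e = fun q => φ (‖red q‖ ^ 2)) :
    cr.fermiSurfaceRep e = sphere (0 : E) 1 := by
  ext q
  rw [Crystal.mem_fermiSurfaceRep, mem_sphere_zero_iff_norm]
  constructor
  · rintro ⟨h0, hqF⟩
    rwa [band_eq_zero_iff hφ he, red_eq_self hred hqF] at h0
  · intro h1
    have hqF : q ∈ cr.fundamentalDomain :=
      hF (by rw [mem_closedBall, dist_zero_right, h1]; norm_num)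
    exact ⟨(band_eq_zero_iff hφ he).2 (by rwa [red_eq_self hred hqF]), hqF⟩

/-! ### §4 The hypotheses (A2)–(A5), (Sy) and the geometric constants for the isotropic band -/

/-- (A2)_{k,0} for the isotropic band. [folklore] -/
private theorem band_hypA2 [FiniteDimensional ℝ E]
    (hφ : φ = fun s => (s - 1) / 2 + Real.smoothTransition ((s - 9 / 4) * (4 / 7)) * ((3 - s) / 2))
    (hred : ∀ q, red q ∈ cr.fundamentalDomain ∧ red q - q ∈ cr.dualLattice)
    (hF : closedBall (0 : E) 3 ⊆ cr.fundamentalDomain) (he : e = fun q => φ (‖red q‖ ^ 2))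
    (hFb : Bornology.IsBounded cr.fundamentalDomain) (k : ℕ) : HypA2 cr k 0 e := by
  refine ⟨fun γ hγ q => band_add hred he hγ, band_memContDiffHolder hφ hred hF he hFb k,
    fun p hp => ?_⟩
  rw [mem_fermiSurface, band_eq_zero_iff hφ he] at hp
  rw [band_gradient hφ hred hF he (by rw [hp]; norm_num)]
  intro h0
  rw [h0, norm_zero] at hp
  exact zero_ne_one hp

/-- (A3) (local half) for the isotropic band. [folklore] -/
private theorem band_hypA3
    (hφ : φ = fun s => (s - 1) / 2 + Real.smoothTransition ((s - 9 / 4) * (4 / 7)) * ((3 - s) / 2))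
    (hred : ∀ q, red q ∈ cr.fundamentalDomain ∧ red q - q ∈ cr.dualLattice)
    (hF : closedBall (0 : E) 3 ⊆ cr.fundamentalDomain) (he : e = fun q => φ (‖red q‖ ^ 2)) :
    HypA3 e := by
  intro p hp v hv _
  rw [mem_fermiSurface, band_eq_zero_iff hφ he] at hp
  rw [band_hessQuad hφ hred hF he (by rw [hp]; norm_num)]
  exact pow_pos (norm_pos_iff.2 hv) 2

omit [CompleteSpace E] in
/-- (A3) (global half) for the isotropic band: `S ∩ F` bounds the unit disc. [folklore] -/
private theorem band_hypA3Global [FiniteDimensional ℝ E]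
    (hφ : φ = fun s => (s - 1) / 2 + Real.smoothTransition ((s - 9 / 4) * (4 / 7)) * ((3 - s) / 2))
    (hred : ∀ q, red q ∈ cr.fundamentalDomain ∧ red q - q ∈ cr.dualLattice)
    (hF : closedBall (0 : E) 3 ⊆ cr.fundamentalDomain) (he : e = fun q => φ (‖red q‖ ^ 2)) :
    HypA3Global cr e :=
  ⟨closedBall 0 1, isCompact_closedBall 0 1, strictConvex_closedBall ℝ (0 : E) 1,
    ⟨0, ball_subset_interior_closedBall (mem_ball_self one_pos)⟩,
    by rw [band_fermiSurfaceRep hφ hred hF he, frontier_closedBall _ one_ne_zero]⟩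

omit [CompleteSpace E] in
/-- (Sy) for the isotropic band. [folklore] -/
private theorem band_hypSy
    (hφ : φ = fun s => (s - 1) / 2 + Real.smoothTransition ((s - 9 / 4) * (4 / 7)) * ((3 - s) / 2))
    (hred : ∀ q, red q ∈ cr.fundamentalDomain ∧ red q - q ∈ cr.dualLattice)
    (hF : closedBall (0 : E) 3 ⊆ cr.fundamentalDomain) (he : e = fun q => φ (‖red q‖ ^ 2)) :
    HypSy e :=
  fun q => band_neg hφ hred hF he q

/-- (A4) for the isotropic band (from (Sy), `FST2FermiCurveParam.HypSy.hypA4`). [folklore] -/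
private theorem band_hypA4
    (hφ : φ = fun s => (s - 1) / 2 + Real.smoothTransition ((s - 9 / 4) * (4 / 7)) * ((3 - s) / 2))
    (hred : ∀ q, red q ∈ cr.fundamentalDomain ∧ red q - q ∈ cr.dualLattice)
    (hF : closedBall (0 : E) 3 ⊆ cr.fundamentalDomain) (he : e = fun q => φ (‖red q‖ ^ 2)) :
    HypA4 cr e :=
  (band_hypSy hφ hred hF he).hypA4 fun p hp => by
    rw [band_fermiSurfaceRep hφ hred hF he, mem_sphere_zero_iff_norm] at hp ⊢
    rwa [norm_neg]

omit [CompleteSpace E] in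
/-- (A5) for the isotropic band: `±p ± q`, `p, q ∈ S ∩ F`, has norm `≤ 2 < 3`. [folklore] -/
private theorem band_hypA5
    (hφ : φ = fun s => (s - 1) / 2 + Real.smoothTransition ((s - 9 / 4) * (4 / 7)) * ((3 - s) / 2))
    (hred : ∀ q, red q ∈ cr.fundamentalDomain ∧ red q - q ∈ cr.dualLattice)
    (hF : closedBall (0 : E) 3 ⊆ cr.fundamentalDomain) (he : e = fun q => φ (‖red q‖ ^ 2)) :
    HypA5 cr e := by
  intro p hp q hq u v hu hv
  rw [band_fermiSurfaceRep hφ hred hF he, mem_sphere_zero_iff_norm] at hp hq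
  have hball : ball (0 : E) 3 ⊆ interior cr.fundamentalDomain := by
    rw [← interior_closedBall (0 : E) (by norm_num : (3 : ℝ) ≠ 0)]
    exact interior_mono hF
  apply hball
  rw [mem_ball, dist_zero_right]
  have hu1 : ‖u‖ = 1 := by rcases hu with rfl | rfl <;> simp
  have hv1 : ‖v‖ = 1 := by rcases hv with rfl | rfl <;> simp
  calc ‖u • p + v • q‖ ≤ ‖u • p‖ + ‖v • q‖ := norm_add_le _ _
    _ = 2 := by rw [norm_smul, norm_smul, hu1, hv1, hp, hq]; norm_num
    _ < 3 := by norm_num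

/-- The geometric constants of the isotropic band: `r₀ = 1/8`, `g₀ = 1/2`, `wmin = 1`. [folklore] -/
private theorem band_geomConstants [FiniteDimensional ℝ E]
    (hφ : φ = fun s => (s - 1) / 2 + Real.smoothTransition ((s - 9 / 4) * (4 / 7)) * ((3 - s) / 2))
    (hred : ∀ q, red q ∈ cr.fundamentalDomain ∧ red q - q ∈ cr.dualLattice)
    (hF : closedBall (0 : E) 3 ⊆ cr.fundamentalDomain) (he : e = fun q => φ (‖red q‖ ^ 2))
    (hFb : Bornology.IsBounded cr.fundamentalDomain) :
    ∃ K : ℝ, GeomConstants e K (1 / 8) (1 / 2) 1 := by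
  obtain ⟨K₀, h₀⟩ := band_exists_bound hφ hred hF he hFb 0
  obtain ⟨K₁, h₁⟩ := band_exists_bound hφ hred hF he hFb 1
  obtain ⟨K₂, h₂⟩ := band_exists_bound hφ hred hF he hFb 2
  refine ⟨max K₀ (max K₁ K₂), ⟨by norm_num, by norm_num, by norm_num, fun p j hj => ?_,
    fun p hp => ?_, fun p hp t _ => ?_⟩⟩
  · interval_cases j
    · exact (h₀ p).trans (le_max_left _ _)
    · exact (h₁ p).trans ((le_max_left _ _).trans (le_max_right _ _))
    · exact (h₂ p).trans ((le_max_right _ _).trans (le_max_right _ _))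
  · have hn : ‖red p‖ < 3 / 2 := norm_red_lt_of_abs_lt hφ he (by linarith)
    rw [band_gradient hφ hred hF he hn]
    have heq := band_eq_of_norm_lt hφ he hn
    rw [heq, abs_lt] at hp
    nlinarith [norm_nonneg (red p)]
  · rw [band_hessQuad hφ hred hF he (norm_red_lt_of_abs_lt hφ he (by linarith)) t, one_mul]

end Band

/-! ### §5 The unit circle of a plane: `θ ↦ cos θ b₀ + sin θ b₁` -/

section Circle

variable {E : Type*} [NormedAddCommGroup E] [InnerProductSpace ℝ E] (b : OrthonormalBasis (Fin 2) ℝ E)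

/-- Norms in an orthonormal basis of a plane. [folklore] -/
private theorem norm_sq_comb (a c : ℝ) : ‖a • b 0 + c • b 1‖ ^ 2 = a ^ 2 + c ^ 2 := by
  have h01 : inner ℝ (b 0) (b 1) = 0 := b.inner_eq_zero (by decide)
  have h10 : inner ℝ (b 1) (b 0) = 0 := b.inner_eq_zero (by decide)
  rw [← real_inner_self_eq_norm_sq]
  simp only [inner_add_left, inner_add_right, real_inner_smul_left, real_inner_smul_right,
    b.inner_eq_one, h01, h10]
  ring

/-- Coordinates in an orthonormal basis of a plane. [folklore] -/
private theorem inner_basis_comb (a c : ℝ) :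
    inner ℝ (b 0) (a • b 0 + c • b 1) = a ∧ inner ℝ (b 1) (a • b 0 + c • b 1) = c := by
  have h01 : inner ℝ (b 0) (b 1) = 0 := b.inner_eq_zero (by decide)
  have h10 : inner ℝ (b 1) (b 0) = 0 := b.inner_eq_zero (by decide)
  simp only [inner_add_right, real_inner_smul_right, b.inner_eq_one, h01, h10]
  constructor <;> ring

/-- Points of the circle have norm one. [folklore] -/
private theorem norm_circle (θ : ℝ) : ‖Real.cos θ • b 0 + Real.sin θ • b 1‖ = 1 := by
  have h := norm_sq_comb b (Real.cos θ) (Real.sin θ)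
  rw [Real.cos_sq_add_sin_sq] at h
  exact (pow_eq_one_iff_of_nonneg (norm_nonneg _) two_ne_zero).1 h

/-- The velocity of the circle has norm one. [folklore] -/
private theorem norm_circle_deriv (θ : ℝ) : ‖-Real.sin θ • b 0 + Real.cos θ • b 1‖ = 1 := by
  have h := norm_sq_comb b (-Real.sin θ) (Real.cos θ)
  rw [neg_sq, Real.sin_sq_add_cos_sq] at h
  exact (pow_eq_one_iff_of_nonneg (norm_nonneg _) two_ne_zero).1 h

/-- The velocity of the circle. [folklore] -/
private theorem hasDerivAt_circle (θ : ℝ) :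
    HasDerivAt (fun θ' => Real.cos θ' • b 0 + Real.sin θ' • b 1)
      (-Real.sin θ • b 0 + Real.cos θ • b 1) θ :=
  ((Real.hasDerivAt_cos θ).smul_const (b 0)).add ((Real.hasDerivAt_sin θ).smul_const (b 1))

/-- The circle is smooth. [folklore] -/
private theorem contDiff_circle {n : WithTop ℕ∞} :
    ContDiff ℝ n (fun θ' => Real.cos θ' • b 0 + Real.sin θ' • b 1) :=
  (Real.contDiff_cos.smul contDiff_const).add (Real.contDiff_sin.smul contDiff_const)

/-- The circle is `2π`-periodic. [folklore] -/
private theorem periodic_circle :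
    Function.Periodic (fun θ' => Real.cos θ' • b 0 + Real.sin θ' • b 1) (2 * Real.pi) := fun θ => by
  simp only [Real.cos_add_two_pi, Real.sin_add_two_pi]

/-- The circle is injective on a period. [folklore] -/
private theorem injOn_circle :
    InjOn (fun θ' => Real.cos θ' • b 0 + Real.sin θ' • b 1) (Ico 0 (2 * Real.pi)) := by
  intro θ₁ hθ₁ θ₂ hθ₂ h
  simp only at h
  have hc : Real.cos θ₁ = Real.cos θ₂ := by
    have h1 := (inner_basis_comb b (Real.cos θ₁) (Real.sin θ₁)).1
    rwa [h, (inner_basis_comb b (Real.cos θ₂) (Real.sin θ₂)).1, eq_comm] at h1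
  have hs : Real.sin θ₁ = Real.sin θ₂ := by
    have h1 := (inner_basis_comb b (Real.cos θ₁) (Real.sin θ₁)).2
    rwa [h, (inner_basis_comb b (Real.cos θ₂) (Real.sin θ₂)).2, eq_comm] at h1
  have hA : (θ₁ : Real.Angle) = θ₂ := Real.Angle.cos_sin_inj hc hs
  have h0 : (0 : ℝ) + 2 * Real.pi = 2 * Real.pi := zero_add _
  rw [← h0] at hθ₁ hθ₂
  haveI : Fact (0 < 2 * Real.pi) := ⟨Real.two_pi_pos⟩
  exact (AddCircle.coe_eq_coe_iff_of_mem_Ico hθ₁ hθ₂).1 hA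

/-- Every unit vector of the plane is on the circle, at a parameter in `[0, 2π)`. [folklore] -/
private theorem exists_circle_eq {x : E} (hx : ‖x‖ = 1) :
    ∃ θ ∈ Ico 0 (2 * Real.pi), Real.cos θ • b 0 + Real.sin θ • b 1 = x := by
  set a₁ : ℝ := inner ℝ (b 0) x with ha₁
  set a₂ : ℝ := inner ℝ (b 1) x with ha₂
  have hx' : a₁ • b 0 + a₂ • b 1 = x := by
    have := b.sum_repr' x
    simpa [Fin.sum_univ_two] using this
  have hsq : a₁ ^ 2 + a₂ ^ 2 = 1 := by
    rw [← norm_sq_comb b, hx', hx, one_pow]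
  set z : ℂ := ⟨a₁, a₂⟩ with hz
  have hnorm : ‖z‖ = 1 := by
    rw [Complex.norm_def, Complex.normSq_mk, show a₁ * a₁ + a₂ * a₂ = 1 by nlinarith, Real.sqrt_one]
  have hz0 : z ≠ 0 := by
    intro h0; rw [h0, norm_zero] at hnorm; exact zero_ne_one hnorm
  have hcos : Real.cos (Complex.arg z) = a₁ := by rw [Complex.cos_arg hz0, hnorm, div_one]
  have hsin : Real.sin (Complex.arg z) = a₂ := by rw [Complex.sin_arg, hnorm, div_one]
  refine ⟨toIcoMod Real.two_pi_pos 0 (Complex.arg z), ?_, ?_⟩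
  · have := toIcoMod_mem_Ico Real.two_pi_pos 0 (Complex.arg z)
    rwa [zero_add] at this
  · rw [← self_sub_toIcoDiv_zsmul, (periodic_circle b).sub_zsmul_eq, hcos, hsin, hx']

end Circle

/-! ### §6 The tubular coordinates `p(ρ, θ) = √(1 + 2ρ) (cos θ b₀ + sin θ b₁)` of the isotropic band -/

section Chart

variable {E : Type*} [NormedAddCommGroup E] [InnerProductSpace ℝ E] (b : OrthonormalBasis (Fin 2) ℝ E)

/-- `‖p(ρ, θ)‖ = √(1 + 2ρ)`. [folklore] -/
private theorem norm_chart (ρ θ : ℝ) :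
    ‖Real.sqrt (1 + 2 * ρ) • (Real.cos θ • b 0 + Real.sin θ • b 1)‖ = Real.sqrt (1 + 2 * ρ) := by
  rw [norm_smul, norm_circle, mul_one, Real.norm_of_nonneg (Real.sqrt_nonneg _)]

/-- `‖p(ρ, θ)‖² = 1 + 2ρ` for `ρ ≥ -1/2`. [folklore] -/
private theorem norm_chart_sq {ρ : ℝ} (hρ : -1 / 2 ≤ ρ) (θ : ℝ) :
    ‖Real.sqrt (1 + 2 * ρ) • (Real.cos θ • b 0 + Real.sin θ • b 1)‖ ^ 2 = 1 + 2 * ρ := by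
  rw [norm_chart, Real.sq_sqrt (by linarith)]

/-- `‖p(ρ, θ)‖ < 3/2` for `ρ < 1/4`. [folklore] -/
private theorem norm_chart_lt {ρ : ℝ} (hρ : ρ < 1 / 4) (θ : ℝ) :
    ‖Real.sqrt (1 + 2 * ρ) • (Real.cos θ • b 0 + Real.sin θ • b 1)‖ < 3 / 2 := by
  rw [norm_chart]
  exact (Real.sqrt_lt' (by norm_num)).2 (by nlinarith)

/-- `∂_ρ p(ρ, θ) = (1 + 2ρ)^{-1/2} (cos θ b₀ + sin θ b₁)`. [folklore] -/
private theorem hasDerivAt_chart {ρ : ℝ} (hρ : -1 / 2 < ρ) (θ : ℝ) :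
    HasDerivAt (fun ρ' => Real.sqrt (1 + 2 * ρ') • (Real.cos θ • b 0 + Real.sin θ • b 1))
      ((Real.sqrt (1 + 2 * ρ))⁻¹ • (Real.cos θ • b 0 + Real.sin θ • b 1)) ρ := by
  have h1 : HasDerivAt (fun ρ' : ℝ => 1 + 2 * ρ') 2 ρ := by
    simpa using ((hasDerivAt_id ρ).const_mul (2 : ℝ)).const_add 1
  have h2 := (h1.sqrt (by linarith)).smul_const (Real.cos θ • b 0 + Real.sin θ • b 1)
  refine h2.congr_deriv ?_
  congr 1
  have hs : Real.sqrt (1 + 2 * ρ) ≠ 0 := (Real.sqrt_pos.2 (by linarith)).ne'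
  field_simp

end Chart

/-! ### §7 Assembly: the band, its angular coordinate and its tubular coordinates -/

section Assembly

variable {E : Type*} [NormedAddCommGroup E] [InnerProductSpace ℝ E] [CompleteSpace E]
  {cr : Crystal E} {φ : ℝ → ℝ} {red : E → E} {e : E → ℝ}

/-- The tubular coordinates of the isotropic band (all the fields of `TubularCoords`). [folklore] -/
private theorem band_tubularCoords (b : OrthonormalBasis (Fin 2) ℝ E)
    (hφ : φ = fun s => (s - 1) / 2 + Real.smoothTransition ((s - 9 / 4) * (4 / 7)) * ((3 - s) / 2))
    (hred : ∀ q, red q ∈ cr.fundamentalDomain ∧ red q - q ∈ cr.dualLattice)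
    (hF : closedBall (0 : E) 3 ⊆ cr.fundamentalDomain) (he : e = fun q => φ (‖red q‖ ^ 2)) (k : ℕ) :
    Nonempty (TubularCoords cr e k (1 / 8)) := by
  -- facts about the chart `p ρ θ = √(1 + 2ρ) (cos θ b₀ + sin θ b₁)` on `|ρ| < 1/4`
  have hmemF : ∀ ρ θ : ℝ, ρ < 1 / 4 →
      Real.sqrt (1 + 2 * ρ) • (Real.cos θ • b 0 + Real.sin θ • b 1) ∈ cr.fundamentalDomain :=
    fun ρ θ hρ => hF (by
      rw [mem_closedBall, dist_zero_right]
      linarith [norm_chart_lt b hρ θ])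
  have hred_p : ∀ ρ θ : ℝ, ρ < 1 / 4 →
      red (Real.sqrt (1 + 2 * ρ) • (Real.cos θ • b 0 + Real.sin θ • b 1)) =
        Real.sqrt (1 + 2 * ρ) • (Real.cos θ • b 0 + Real.sin θ • b 1) :=
    fun ρ θ hρ => red_eq_self hred (hmemF ρ θ hρ)
  have hn : ∀ ρ θ : ℝ, ρ < 1 / 4 →
      ‖red (Real.sqrt (1 + 2 * ρ) • (Real.cos θ • b 0 + Real.sin θ • b 1))‖ < 3 / 2 :=
    fun ρ θ hρ => by rw [hred_p ρ θ hρ]; exact norm_chart_lt b hρ θ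
  have hsphere := band_fermiSurfaceRep hφ hred hF he
  refine ⟨{
    p := fun ρ θ => Real.sqrt (1 + 2 * ρ) • (Real.cos θ • b 0 + Real.sin θ • b 1)
    u := gradient e
    base :=
      { γ := fun θ => Real.cos θ • b 0 + Real.sin θ • b 1
        dγ := fun θ => -Real.sin θ • b 0 + Real.cos θ • b 1
        P := 1
        P_pos := one_pos
        periodic := periodic_circle b
        mem := fun θ => by
          rw [hsphere, mem_sphere_zero_iff_norm]
          exact norm_circle b θ
        surjOn := fun x hx => by
          rw [hsphere, mem_sphere_zero_iff_norm] at hx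
          obtain ⟨θ, hθ, h⟩ := exists_circle_eq b hx
          exact ⟨θ, hθ, h⟩
        injOn := injOn_circle b
        hasDerivAt := hasDerivAt_circle b
        norm_dγ := fun θ => by rw [norm_circle_deriv, inv_one] }
    r₀_pos := by norm_num
    p_zero := by
      funext θ
      simp
    u_contDiff := band_gradient_contDiff hφ hred hF he
    u_periodic := fun γ hγ q => band_gradient_add hred he hγ
    u_transversal := ?_
    hasDerivAt_rho := ?_
    level := ?_
    periodic := fun ρ θ => by
      simp only [Real.cos_add_two_pi, Real.sin_add_two_pi]
    contDiffOn := ?_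
    injOn := ?_
    covers := ?_ }⟩
  · -- (uzerinit): `u·∇e = ‖∇e‖² = ‖red q‖² = 1 + 2 e(q) > 1/2` on `|e| < 1/4`
    refine ⟨1 / 2, by norm_num, fun q hq => ?_⟩
    have hnq : ‖red q‖ < 3 / 2 := norm_red_lt_of_abs_lt hφ he (by linarith)
    rw [band_gradient hφ hred hF he hnq, real_inner_self_eq_norm_sq]
    have heq := band_eq_of_norm_lt hφ he hnq
    rw [heq, abs_lt] at hq
    nlinarith
  · -- `∂_ρ p = u/(u·∇e)` at `p(ρ, θ)`: `∇e(p) = p`, `u·∇e = ‖p‖² = 1 + 2ρ`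
    intro θ ρ hρ
    simp only [mem_Ioo] at hρ
    have hρ1 : -1 / 2 < ρ := by linarith [hρ.1]
    have hρ2 : ρ < 1 / 4 := by linarith [hρ.2]
    refine (hasDerivAt_chart b hρ1 θ).congr_deriv ?_
    rw [band_gradient hφ hred hF he (hn ρ θ hρ2), hred_p ρ θ hρ2, real_inner_self_eq_norm_sq,
      norm_chart_sq b hρ1.le, smul_smul]
    congr 1
    have hss : Real.sqrt (1 + 2 * ρ) * Real.sqrt (1 + 2 * ρ) = 1 + 2 * ρ :=
      Real.mul_self_sqrt (by linarith)
    symm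
    apply eq_inv_of_mul_eq_one_left
    rw [mul_assoc, hss, inv_mul_cancel₀ (by linarith : (1 + 2 * ρ) ≠ 0)]
  · -- `e(p(ρ, θ)) = ρ`
    intro θ ρ hρ
    simp only [mem_Ioo] at hρ
    have hρ2 : ρ < 1 / 4 := by linarith [hρ.2]
    rw [band_eq_of_norm_lt hφ he (hn ρ θ hρ2), hred_p ρ θ hρ2, norm_chart_sq b (by linarith [hρ.1])]
    ring
  · -- `C^k` on the strip
    intro x hx
    rw [mem_prod, mem_Ioo] at hx
    have hx1 : 1 + 2 * x.1 ≠ 0 := by linarith [hx.1.1]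
    apply ContDiffAt.contDiffWithinAt
    show ContDiffAt ℝ k
      (fun y : ℝ × ℝ => Real.sqrt (1 + 2 * y.1) • (Real.cos y.2 • b 0 + Real.sin y.2 • b 1)) x
    exact ((contDiffAt_const.add (contDiffAt_const.mul contDiffAt_fst)).sqrt hx1).smul
      ((contDiff_circle b).contDiffAt.comp x contDiffAt_snd)
  · -- injective on a period
    intro ρ hρ θ₁ hθ₁ θ₂ hθ₂ heq
    simp only [mem_Ioo] at hρ
    have hs : Real.sqrt (1 + 2 * ρ) ≠ 0 := (Real.sqrt_pos.2 (by linarith [hρ.1])).ne'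
    exact injOn_circle b hθ₁ hθ₂ (smul_right_injective E hs heq)
  · -- the coordinates cover the tube `{|e| < 1/4}`
    intro q hq
    have hnq : ‖red q‖ < 3 / 2 := norm_red_lt_of_abs_lt hφ he (by linarith)
    have heq := band_eq_of_norm_lt hφ he hnq
    have hsq : 1 + 2 * e q = ‖red q‖ ^ 2 := by rw [heq]; ring
    have hpos : (1 : ℝ) / 2 < ‖red q‖ ^ 2 := by
      rw [heq, abs_lt] at hq
      linarith [hq.1]
    have hr0 : red q ≠ 0 := by
      intro h0
      rw [h0, norm_zero] at hpos
      norm_num at hpos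
    obtain ⟨θ, -, hθ⟩ := exists_circle_eq b (x := ‖red q‖⁻¹ • red q)
      (by rw [norm_smul, norm_inv, norm_norm, inv_mul_cancel₀ (norm_ne_zero_iff.2 hr0)])
    refine ⟨red q - q, (hred q).2, θ, ?_⟩
    show Real.sqrt (1 + 2 * e q) • (Real.cos θ • b 0 + Real.sin θ • b 1) = q + (red q - q)
    rw [hθ, add_sub_cancel, hsq, Real.sqrt_sq (norm_nonneg _),
      smul_inv_smul₀ (norm_ne_zero_iff.2 hr0)]

/-- **The tubular coordinates and all hypotheses of [II] Chapter 3 are inhabited** by the isotropic band,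
for `d = 2` and every crystal whose fundamental domain is bounded and contains the ball `‖p‖ ≤ 3`: there
is a `C^∞` `Γ#`-periodic symmetric band `e` with `S ∩ F` the unit circle, satisfying (A2)_{k,0}, (A3)
(both halves), (Sy), (A4), (A5), with geometric constants `(K, r₀, g₀, wmin) = (K, 1/8, 1/2, 1)`, an
angular coordinate (`FermiCurveParam`, [II] §2.2 p.9 L40–62) and tubular coordinates
`TubularCoords cr e k (1/8)` ([II] §2.2 p.8 L35–60) for every `k`. A non-vacuity witness for the data of
`FST2SecondOrderStrings.lean`; the general construction of [I, Lemma 2.1] is not formalised.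
[cite: FeldmanSalmhoferTrubowitz1998, §2.2 (arXiv p.8 L35–60)] -/
theorem exists_band_tubularCoords [FiniteDimensional ℝ E] (hd : Module.finrank ℝ E = 2) (cr : Crystal E)
    (hF : closedBall (0 : E) 3 ⊆ cr.fundamentalDomain) (hFb : Bornology.IsBounded cr.fundamentalDomain)
    (k : ℕ) :
    ∃ e : E → ℝ, ContDiff ℝ (⊤ : ℕ∞) e ∧ IsLatticePeriodic cr.dualLattice e ∧
      cr.fermiSurfaceRep e = sphere 0 1 ∧ HypA2 cr k 0 e ∧ HypA3 e ∧ HypA3Global cr e ∧ HypSy e ∧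
      HypA4 cr e ∧ HypA5 cr e ∧ (∃ K : ℝ, GeomConstants e K (1 / 8) (1 / 2) 1) ∧
      Nonempty (FermiCurveParam cr e) ∧ Nonempty (TubularCoords cr e k (1 / 8)) := by
  set φ : ℝ → ℝ := fun s => (s - 1) / 2 + Real.smoothTransition ((s - 9 / 4) * (4 / 7)) * ((3 - s) / 2)
    with hφ
  obtain ⟨red, hred⟩ : ∃ red : E → E, ∀ q, red q ∈ cr.fundamentalDomain ∧ red q - q ∈ cr.dualLattice :=
    ⟨fun q => q + ((cr.existsUnique_rep q).exists.choose : E), fun q =>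
      ⟨(cr.existsUnique_rep q).exists.choose_spec, by simp⟩⟩
  set e : E → ℝ := fun q => φ (‖red q‖ ^ 2) with he
  let b : OrthonormalBasis (Fin 2) ℝ E := (stdOrthonormalBasis ℝ E).reindex (finCongr hd)
  obtain ⟨Φ⟩ := band_tubularCoords b hφ hred hF he k
  exact ⟨e, band_contDiff hφ hred hF he, fun γ hγ q => band_add hred he hγ,
    band_fermiSurfaceRep hφ hred hF he, band_hypA2 hφ hred hF he hFb k, band_hypA3 hφ hred hF he,
    band_hypA3Global hφ hred hF he, band_hypSy hφ hred hF he, band_hypA4 hφ hred hF he,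
    band_hypA5 hφ hred hF he, band_geomConstants hφ hred hF he hFb, ⟨Φ.base⟩, ⟨Φ⟩⟩

end Assembly

/-! ### §8 The cubic crystal `Γ# = 2πℤ^d`, `F = [-π, π)^d` qualifies; the hypotheses of Theorem 3.5 and
Lemma 3.1 are jointly satisfiable -/

section Cubic

/-- The ball `‖p‖ ≤ 3` lies in the fundamental domain `[-π, π)^d` of the cubic crystal (`3 < π`).
[cite: FeldmanSalmhoferTrubowitz1998, §2.1 (arXiv p.6 L112–114)] -/
theorem closedBall_subset_fundamentalDomain_cubic (d : ℕ) :
    closedBall (0 : EuclideanSpace ℝ (Fin d)) 3 ⊆ (Crystal.cubic d).fundamentalDomain := by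
  intro p hp i
  rw [mem_closedBall, dist_zero_right] at hp
  have hi : |p i| ≤ 3 := by
    have h := PiLp.norm_apply_le p i
    rw [Real.norm_eq_abs] at h
    exact h.trans hp
  rw [abs_le] at hi
  constructor <;> linarith [Real.pi_gt_three]

/-- The fundamental domain `[-π, π)^d` of the cubic crystal is bounded.
[cite: FeldmanSalmhoferTrubowitz1998, §2.1 (arXiv p.6 L112–114)] -/
theorem isBounded_fundamentalDomain_cubic (d : ℕ) :
    Bornology.IsBounded (Crystal.cubic d).fundamentalDomain := by
  refine (isBounded_closedBall (x := (0 : EuclideanSpace ℝ (Fin d))) (r := Real.sqrt (d * Real.pi ^ 2))).subset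
    fun p hp => ?_
  rw [mem_closedBall, dist_zero_right, EuclideanSpace.norm_eq]
  refine Real.sqrt_le_sqrt ?_
  calc ∑ i, ‖p i‖ ^ 2 ≤ ∑ _i : Fin d, Real.pi ^ 2 := Finset.sum_le_sum fun i _ => by
          have h := hp i
          rw [Real.norm_eq_abs, sq_abs]
          exact sq_le_sq' (by linarith [h.1]) h.2.le
    _ = d * Real.pi ^ 2 := by simp

/-- The fundamental domain `[-π, π)^d` of the cubic crystal is measurable.
[cite: FeldmanSalmhoferTrubowitz1998, §2.1 (arXiv p.6 L112–114)] -/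
theorem measurableSet_fundamentalDomain_cubic (d : ℕ) :
    MeasurableSet (Crystal.cubic d).fundamentalDomain := by
  have h : (Crystal.cubic d).fundamentalDomain =
      ⋂ i : Fin d, (fun p : EuclideanSpace ℝ (Fin d) => p i) ⁻¹' Ico (-Real.pi) Real.pi := by
    ext p
    simp only [mem_iInter, mem_preimage, mem_Ico]
    rfl
  rw [h]
  exact MeasurableSet.iInter fun i =>
    measurableSet_Ico.preimage ((EuclideanSpace.proj i).continuous.measurable)

/-- **The hypotheses of [II] Theorem 3.5 (`StringsTheorem`) and Lemma 3.1 (`LemmaJaythree`) are jointly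
satisfiable**: for every `k ≥ 2` there are a crystal on `ℝ²` (the cubic one), a band `e`, constants
`K, r₀, g₀, wmin` and a scale parameter `M` such that `dim = 2`, `F` is measurable and bounded,
(A2)_{k,0}, (A3) (both halves), (A4), (A5) and `GeomConstants e K r₀ g₀ wmin` hold, `M ≥ max{4³, 1/r₀}`,
and the angular coordinate `FermiCurveParam cr e`, the tubular coordinates `TubularCoords cr e k r₀` and
the cutoff `ScaleCutoff M` are all inhabited — i.e. everything the two named facts quantify over before
"`∃ Q`" / "`∃ Δ`" (the constants `Γ_{l,ν,s}` of Theorem 3.5 are quantified there too, under the sole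
hypothesis that they increase in `s`, met by any constant family). So neither fact is vacuously true.
[cite: FeldmanSalmhoferTrubowitz1998, Theorem 3.5 and Lemma 3.1 (arXiv p.18 L91–138, p.15 L36–46)] -/
theorem stringsTheorem_hypotheses_nonempty (k : ℕ) (hk : 2 ≤ k) :
    ∃ (cr : Crystal (EuclideanSpace ℝ (Fin 2))) (e : EuclideanSpace ℝ (Fin 2) → ℝ) (K r₀ g₀ wmin M : ℝ),
      Module.finrank ℝ (EuclideanSpace ℝ (Fin 2)) = 2 ∧ MeasurableSet cr.fundamentalDomain ∧
      Bornology.IsBounded cr.fundamentalDomain ∧ 2 ≤ k ∧ HypA2 cr k 0 e ∧ HypA3 e ∧ HypA3Global cr e ∧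
      HypA4 cr e ∧ HypA5 cr e ∧ GeomConstants e K r₀ g₀ wmin ∧ max (4 ^ 3) r₀⁻¹ ≤ M ∧
      Nonempty (FermiCurveParam cr e) ∧ Nonempty (TubularCoords cr e k r₀) ∧ Nonempty (ScaleCutoff M) := by
  obtain ⟨e, -, -, -, hA2, hA3, hA3G, -, hA4, hA5, ⟨K, hG⟩, hΘ, hΦ⟩ :=
    exists_band_tubularCoords finrank_euclideanSpace_fin (Crystal.cubic 2)
      (closedBall_subset_fundamentalDomain_cubic 2) (isBounded_fundamentalDomain_cubic 2) k
  have hM : max (4 ^ 3 : ℝ) (1 / 8)⁻¹ ≤ 4 ^ 3 := by norm_num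
  exact ⟨Crystal.cubic 2, e, K, 1 / 8, 1 / 2, 1, 4 ^ 3, finrank_euclideanSpace_fin,
    measurableSet_fundamentalDomain_cubic 2, isBounded_fundamentalDomain_cubic 2, hk, hA2, hA3, hA3G, hA4,
    hA5, hG, hM, hΘ, hΦ, ScaleCutoff.nonempty_of_le hM⟩

end Cubic

end Literature.MathematicalPhysics.QuantumLattice.FermiRG

end
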